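import Summits.BirchSwinnertonDyer.BirchSwinnertonDyer.Theorems.EisensteinDepletionAtTwoStarOptBNSFNsfDoorPrint
import Summits.BirchSwinnertonDyer.BirchSwinnertonDyer.Theorems.EisensteinDepletionAtTwoStarRestrictedGlue
import HarnessLib

/-!
# The load-bearing crux `E1M_NSF` from its kummer child and two print named facts (route `EisensteinDepletionAtTwo`, stmt-BirchSwinnertonDyer-27021)

Lead star-p1 GEN 12.  Composition of the landed nsf end state `…NsfDoorPrint.starOptBNSF_of_print`
(`exists_isNewformOf → exists_optimal_gamma1ParametrizationData → UBD → StarOptBNSF`, crux 27047) with the landed split glue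
`…DepletionAtTwo.depletedLambdaLawAtTwoModNSFOfStar_proof` (item 27048: `StarGO2Sigma → StarOptBNSF → E1M_NSF`).  The modularity
input is the ANTECEDENT of `E1M_NSF` itself (its body starts with `exists_isNewformOf`), so it is discharged:

  **`E1M_NSF` ⇐ `StarGO2Sigma` (crux 27046, open) ∧ CES/Stevens optimal `Γ₁(N)`-datum (print) ∧ unbounded denominators (print).**

CONDITIONAL; closes nothing by itself; nothing here reads `r_an`; `StarGO2Sigma` / E1M_NSF / E1M / BSD are NOT proved by this file.
-/

set_option linter.dupNamespace false
set_option autoImplicit false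

namespace Summit.BirchSwinnertonDyer.BirchSwinnertonDyer.Theorems.DepletionAtTwo.NsfDoorParent

open Literature.NumberTheory.EllipticCurves
open Literature.NumberTheory.EllipticCurves.Greenberg1999
open Literature.NumberTheory.EllipticCurves.ModularForms

/-- **`E1M_NSF` (= `DepletedLambdaLawAtTwoModNSF`, the door's load-bearing crux, item 27021) from the sibling crux `StarGO2Sigma`
(item 27046) and the two PRINT named facts `exists_optimal_gamma1ParametrizationData` (Conrad–Edixhoven–Stein 6.1.6 / Stevens: the
optimal `Γ₁(N)`-datum with integer Manin constant) and `CalegariDimitrovTang2025_unboundedDenominators`** — the nsf half of line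
`star` is print (GEN 12), the modularity input is `E1M_NSF`'s own antecedent.
[cite: GreenbergVatsal2000, §3 Thm. (3.12)] [cite: ConradEdixhovenStein2003, §6.1 Lemma 6.1.6] [cite: CalegariDimitrovTang2025, Thm. 1.0.1] -/
theorem depletedLambdaLawAtTwoModNSF_of_starGO2Sigma_of_print
    (hex : exists_optimal_gamma1ParametrizationData)
    (hU : Literature.NumberTheory.Automorphic.CalegariDimitrovTang2025_unboundedDenominators)
    (hG : Summit.BirchSwinnertonDyer.BirchSwinnertonDyer.Theses.EisensteinDepletionAtTwo.StarGO2Sigma) :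
    Summit.BirchSwinnertonDyer.BirchSwinnertonDyer.Theses.EisensteinDepletionAtTwo.DepletedLambdaLawAtTwoModNSF := by
  intro hmod
  exact Summit.BirchSwinnertonDyer.BirchSwinnertonDyer.Theorems.DepletionAtTwo.depletedLambdaLawAtTwoModNSFOfStar_proof hG
    (Summit.BirchSwinnertonDyer.BirchSwinnertonDyer.Theorems.DepletionAtTwo.NsfDoorPrint.starOptBNSF_of_print hmod hex hU) hmod

end Summit.BirchSwinnertonDyer.BirchSwinnertonDyer.Theorems.DepletionAtTwo.NsfDoorParent
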